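/-
Copyright (c) 2026. All rights reserved.
Released under Apache 2.0 license as described in the file LICENSE.
Authors: abc-iut cell, statement-typer seat abc-iut-L4-t3 (wave 1; gen 8), over abc-iut-f-101's frames
(`LogFrobeniusMonoTelecoreFrames/FrameIsos/FrameLifts/Precomp/Postcomp/Contact`) and abc-iut-L4-t5's relative families.
-/
import Literature.AnabelianGeometry.AbsoluteAnabelian.LogFrobeniusIotaAnMonoChains
import Literature.AnabelianGeometry.AbsoluteAnabelian.LogFrobeniusMonoTelecorePinnedIota
import HarnessLib

/-!
# [AbsTopIII] Cor 5.10 (iv)(c): the contact structure `ℋ_{An⊢}` EXTENDED by the `ι^{An⊢⊞}`-generators — the relative family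

S. Mochizuki, *Topics in absolute anabelian geometry III*, J. Math. Sci. Univ. Tokyo 22 (2015) 939–1156
[MochizukiAbsTopIII2015]; manuscript pages (`paper:url-5493eb38cbb7`): Cor 5.10 (iv)(c) p. 148 l. 39–51 ("the resulting
homotopies `η⊢_{v,ν}`, `(η⊢_{v,ν})⁻¹`, together with … the homotopies on `D_{An⊢}` arising from the `ι^{An⊢⊞}_{v,ε}` … generate a
contact structure `ℋ_{An⊢}`"); Def 3.5 (ii) p. 75, (iv) p. 76; §0 p. 26 (saturation); Rmk 3.5.1 p. 78.

WHY («F-0139″-CLOSER», second brick; proof-side companion of `LogFrobeniusMonoTelecorePinnedIota.lean`, nothing restated).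
abc-iut-f-101's `monoContact` relates two paths into `𝒩⊢⊞_v` only inside ONE class `A_ν` (`MRel`), by the frame ISOMORPHISM
`Θ_p ≫ Θ_q⁻¹`; the `ι^{An⊢⊞}`-pair `([φ_{ν₁}], [φ_{ν₂}])` joins two classes by a non-invertible homotopy.  Here the relative lifts
are EXTENDED over the `ι^{An⊢⊞}`-data `I` (this lineage's `IotaAnMono`):
* `MRelI` — at `𝒩⊢⊞_v`: `p ∈ A_{ν₁}`, `q ∈ A_{ν₂}` with `ν₁ ⤳ ν₂` REACHABLE in `Γ⃗×_v` (`LogFrobeniusIotaAnMonoChains`); all pairs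
  at the core vertex; closed under the saturation moves (`mrelI_*`);
* `θI := Θ_p ≫ (N_a ◁ ι^{An⊢⊞}_{ν₁ ⤳ ν₂}) ≫ Θ_q⁻¹` (abc-iut-f-101's frames, this lineage's `IotaAnMono.chain`); `θI_eq` (any
  witnesses), `θI_eq_θAt` (on a same-class pair it IS `θAt`); the laws of Def 3.5 (ii): `θI_self`, `θI_trans` UNDER
  `I.SquaresCommute` (Def 5.4 (iii): one composite per reachable pair), `θI_precomp_heq` (naturality of the chain), and
  `θI_over` — `θI` lies over the structure isomorphisms EXACTLY as `θAt` (`ι^{An⊢⊞}` lies over the identity of `Th⊢[Z]`,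
  `chain_over`), whence post-composition by abc-iut-f-101's generic `lift_comp_heq_of_over` / `θAt_comp_tel_heq`;
The `RelLifts` datum, the family `ℋ_{An⊢}` with the `ι^{An⊢⊞}`-generators, its compatibility with `𝒥`, the printed pairs and
`Cor510MonoTelecorePinnedIota` follow in the third brick (`LogFrobeniusMonoTelecoreIotaContact.lean`).  Hypotheses:
abc-iut-f-101's `hN`, `hψ`, `hη`, `hcoh`, the data `I` over `hψ`, `I.SquaresCommute`; NOT `EtaNatural` (it constrains `ℋ_{An⊢}`
against the observables `S_log⊞`, abc-iut-w5-d144's lane).  Refereed pre-IUT material; OUR constructions over a typed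
interface; nothing here bears on [IUTchIII] Cor. 3.12; no side taken; typed ≠ proved.
-/

set_option autoImplicit false

universe u

open CategoryTheory Quiver

namespace Literature.AnabelianGeometry.AbsoluteAnabelian

namespace LogFrobeniusSetting

variable {Vmod : Type u} {isArc : Vmod → Bool}

/-! ## The extended relation -/

/-- **The related pairs of the extended contact structure**: every pair into the core vertex; at `𝒩⊢⊞_v` the pairs `(p, q)`
with `p ∈ A_{ν₁}`, `q ∈ A_{ν₂}` and `ν₁ ⤳ ν₂` reachable in `Γ⃗×_v`; none elsewhere.
[cite: MochizukiAbsTopIII2015, Cor 5.10 (iv)(c) p.148] -/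
def MRelI : ∀ {a w : (monoTeleShape Vmod isArc).Vertex}, Path a w → Path a w → Prop
  | _, ExtVertex.obs, _, _ => True
  | _, ExtVertex.base ⟨.nmonoPlus v, _⟩, p, q =>
      ∃ (ν₁ ν₂ : LogVertex (isArc v)) (hν₁ : ν₁.IsCross) (hν₂ : ν₂.IsCross),
        InA v ν₁ hν₁ p ∧ InA v ν₂ hν₂ q ∧ ν₁.Reach ν₂
  | _, ExtVertex.base ⟨.row1 _, _⟩, _, _ => False
  | _, ExtVertex.base ⟨.core, _⟩, _, _ => False
  | _, ExtVertex.base ⟨.nplus _, _⟩, _, _ => False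
  | _, ExtVertex.base ⟨.nv _, _⟩, _, _ => False
  | _, ExtVertex.base ⟨.e5, _⟩, _, _ => False
  | _, ExtVertex.base ⟨.an, _⟩, _, _ => False
  | _, ExtVertex.base ⟨.e7, _⟩, _, _ => False
  | _, ExtVertex.base ⟨.nmono _, _⟩, _, _ => False
  | _, ExtVertex.base ⟨.emono5, _⟩, _, _ => False
  | _, ExtVertex.base ⟨.anMono, _⟩, _, _ => False
  | _, ExtVertex.base ⟨.emono7, _⟩, _, _ => False

section Rel

variable {a : (monoTeleShape Vmod isArc).Vertex}

/-- At `𝒩⊢⊞_v` the extended relation is "classes joined by reachability". [cite: MochizukiAbsTopIII2015, Cor 5.10 (iv)(c) p.148] -/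
theorem mrelI_nmonoPlus_iff {v : Vmod} (p q : Path a (nmonoPlusVx (isArc := isArc) v)) :
    MRelI p q ↔ ∃ (ν₁ ν₂ : LogVertex (isArc v)) (hν₁ : ν₁.IsCross) (hν₂ : ν₂.IsCross),
      InA v ν₁ hν₁ p ∧ InA v ν₂ hν₂ q ∧ ν₁.Reach ν₂ := Iff.rfl

/-- abc-iut-f-101's same-class pairs are related (reachability is reflexive on the vertices of `Γ⃗×_v`).
[cite: MochizukiAbsTopIII2015, Cor 5.10 (iv)(c) p.148] -/
theorem mrelI_of_mrel {w : (monoTeleShape Vmod isArc).Vertex} {p q : Path a w} (hw : MW w) (h : MRel p q) :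
    MRelI p q := by
  rcases eq_of_mw hw with rfl | ⟨v, rfl⟩
  · trivial
  · obtain ⟨ν, hν, hp, hq⟩ := h
    exact ⟨ν, ν, hν, hν, hp, hq, LogVertex.Reach.refl hν⟩

/-- §0 (a), left. [cite: MochizukiAbsTopIII2015, Section 0 p.26] -/
theorem mrelI_refl_left {w : (monoTeleShape Vmod isArc).Vertex} {p q : Path a w} (hw : MW w) (h : MRelI p q) :
    MRelI p p := by
  rcases eq_of_mw hw with rfl | ⟨v, rfl⟩
  · trivial
  · obtain ⟨ν₁, -, hν₁, -, hp, -, -⟩ := h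
    exact ⟨ν₁, ν₁, hν₁, hν₁, hp, hp, LogVertex.Reach.refl hν₁⟩

/-- §0 (a), right. [cite: MochizukiAbsTopIII2015, Section 0 p.26] -/
theorem mrelI_refl_right {w : (monoTeleShape Vmod isArc).Vertex} {p q : Path a w} (hw : MW w) (h : MRelI p q) :
    MRelI q q := by
  rcases eq_of_mw hw with rfl | ⟨v, rfl⟩
  · trivial
  · obtain ⟨-, ν₂, -, hν₂, -, hq, -⟩ := h
    exact ⟨ν₂, ν₂, hν₂, hν₂, hq, hq, LogVertex.Reach.refl hν₂⟩

/-- §0 (c): transitivity (the middle class is determined by the middle path; reachability composes).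
[cite: MochizukiAbsTopIII2015, Section 0 p.26] -/
theorem mrelI_trans {w : (monoTeleShape Vmod isArc).Vertex} {p q r : Path a w} (hw : MW w) (h₁ : MRelI p q)
    (h₂ : MRelI q r) : MRelI p r := by
  rcases eq_of_mw hw with rfl | ⟨v, rfl⟩
  · trivial
  · obtain ⟨ν₁, ν₂, hν₁, hν₂, hp, hq, h12⟩ := h₁
    obtain ⟨ν₂', ν₃, hν₂', hν₃, hq', hr, h23⟩ := h₂
    obtain rfl : ν₂ = ν₂' := hq.ν_eq hq'
    exact ⟨ν₁, ν₃, hν₁, hν₃, hp, hr, h12.trans h23⟩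

/-- §0 (d): pre-composition. [cite: MochizukiAbsTopIII2015, Section 0 p.26] -/
theorem mrelI_precomp {c w : (monoTeleShape Vmod isArc).Vertex} (r : Path c a) {p q : Path a w} (hw : MW w)
    (h : MRelI p q) : MRelI (r.comp p) (r.comp q) := by
  rcases eq_of_mw hw with rfl | ⟨v, rfl⟩
  · trivial
  · obtain ⟨ν₁, ν₂, hν₁, hν₂, hp, hq, h12⟩ := h
    exact ⟨ν₁, ν₂, hν₁, hν₂, hp.precomp r, hq.precomp r, h12⟩

/-- §0 (e): post-composition by a path between vertices of `W` (as for `MRel`: a nonempty path into `𝒩⊢⊞_{v′}` ends with a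
telecore edge, so both composites fall into ONE class). [cite: MochizukiAbsTopIII2015, Section 0 p.26] -/
theorem mrelI_postcomp {w w' : (monoTeleShape Vmod isArc).Vertex} {p q : Path a w} (t : Path w w') (hw : MW w)
    (hw' : MW w') (h : MRelI p q) : MRelI (p.comp t) (q.comp t) := by
  rcases eq_of_mw hw' with rfl | ⟨v', rfl⟩
  · trivial
  · cases t with
    | nil => exact h
    | cons t e =>
      rename_i b
      rcases b with ⟨⟨b, hb⟩⟩ | _
      · change DEdge isArc b (.nmonoPlus v') at e
        cases e
        exact ((notTop_of_path t (mw_notTop hw) : NotTop _) : False).elim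
      · change MonoTelecoreIdx (DVertex.nmonoPlus (isArc := isArc) v') at e
        obtain ⟨ν', hν'⟩ := e
        exact ⟨ν', ν', hν', hν', inA_cons_telE hν' (p.comp t), inA_cons_telE hν' (q.comp t),
          LogVertex.Reach.refl hν'⟩

/-- the `ι^{An⊢⊞}`-pair `([φ_{ν₁}] ∘ R, [φ_{ν₂}] ∘ R)` along an edge of `Γ⃗×_v` is related (with any common prefix `R`).
[cite: MochizukiAbsTopIII2015, Cor 5.10 (iv)(c) p.148] -/
theorem mrelI_cons_telE {v : Vmod} (R : Path a (coreVx Vmod isArc)) {ν₁ ν₂ : LogVertex (isArc v)}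
    (ε : LogEdgeTS (isArc v) ν₁ ν₂) (hε : ε.InCore) :
    MRelI (R.cons (telE v ν₁ hε.isCross_src)) (R.cons (telE v ν₂ hε.isCross_tgt)) :=
  ⟨ν₁, ν₂, hε.isCross_src, hε.isCross_tgt, inA_cons_telE _ R, inA_cons_telE _ R, LogVertex.Reach.of_inCore hε⟩

end Rel

/-! ## The extended lift `θI` at `𝒩⊢⊞_v` -/

variable (L : LogFrobeniusSetting Vmod isArc)
  (hN : ∀ v : Vmod, L.monoN v ⋙ L.toEmono v ≅ L.toE v ⋙ L.monoAn)
  (hψ : ∀ (w : Vmod) (j : {ν : LogVertex (isArc w) // ν.IsCross}),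
    L.ψAnMono w j ⋙ L.forgetMono w ⋙ L.toEmono w ≅ L.κAnMono.inverse)
  (hη : ∀ (v : Vmod) (ν : LogVertex (isArc v)) (hν : ν.IsCross),
    L.lam v ν ⋙ L.forget v ⋙ L.toE v ⋙ L.monoAn ⋙ L.κAnMono.functor ⋙ L.ψAnMono v ⟨ν, hν⟩ ≅ L.lam v ν ⋙ L.monoNplus v)
  (I : L.IotaAnMono hψ)

-- the coherence hypothesis `hcoh`: «`η⊢_{v,ν}` lies over `ℰ⊢`» (abc-iut-f-101's binder, verbatim)
variable (hcoh : ∀ (v : Vmod) (ν : LogVertex (isArc v)) (hν : ν.IsCross) (y : L.X),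
  (L.toEmono v).map ((L.forgetMono v).map ((hη v ν hν).hom.app y)) ≫
    (L.toEmono v).map ((L.monoHomotopy v).hom.app ((L.lam v ν).obj y)) ≫
      (hN v).hom.app ((L.forget v).obj ((L.lam v ν).obj y)) =
  (hψ v ⟨ν, hν⟩).hom.app ((L.lam v ν ⋙ L.forget v ⋙ L.toE v ⋙ L.monoAn ⋙ L.κAnMono.functor).obj y) ≫
    L.κAnMono.unitIso.inv.app ((L.lam v ν ⋙ L.forget v ⋙ L.toE v ⋙ L.monoAn).obj y))

section Theta

variable {v : Vmod} {a : (monoTeleShape Vmod isArc).Vertex}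

/-- **the extended relative lift at `𝒩⊢⊞_v`**: for `p ∈ A_{ν₁}`, `q ∈ A_{ν₂}`, `ν₁ ⤳ ν₂`, the frame of `p`, then `ι^{An⊢⊞}` along
`ν₁ ⤳ ν₂` under the structure functor of the source vertex, then the inverse frame of `q` (on a same-class pair: abc-iut-f-101's
`θAt`). [cite: MochizukiAbsTopIII2015, Definition 3.5 (ii) p.75] -/
noncomputable def θI {p q : Path a (nmonoPlusVx v)} (hr : MRelI p q) :
    L.monoTeleDiagram.pathFunctor p ⟶ L.monoTeleDiagram.pathFunctor q :=
  (L.Θ hN hψ hη ((mrelI_nmonoPlus_iff p q).mp hr).choose_spec.choose_spec.choose_spec.choose_spec.1.wit).hom ≫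
    Functor.whiskerLeft ((L.monoTeleOver hN hψ).N a)
      (I.chain v ((mrelI_nmonoPlus_iff p q).mp hr).choose_spec.choose_spec.choose_spec.choose_spec.2.2) ≫
    (L.Θ hN hψ hη ((mrelI_nmonoPlus_iff p q).mp hr).choose_spec.choose_spec.choose_spec.choose_spec.2.1.wit).inv

/-- the extended lift computed from ANY witnesses. [cite: MochizukiAbsTopIII2015, Definition 3.5 (ii) p.75] -/
theorem θI_eq {p q : Path a (nmonoPlusVx v)} (hr : MRelI p q) {ν₁ ν₂ : LogVertex (isArc v)} {hν₁ : ν₁.IsCross}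
    {hν₂ : ν₂.IsCross} (wp : TelWit v ν₁ hν₁ p ⊕ LamWit v ν₁ hν₁ p) (wq : TelWit v ν₂ hν₂ q ⊕ LamWit v ν₂ hν₂ q)
    (h : ν₁.Reach ν₂) :
    L.θI hN hψ hη I hr = (L.Θ hN hψ hη wp).hom ≫
      Functor.whiskerLeft ((L.monoTeleOver hN hψ).N a) (I.chain v h) ≫ (L.Θ hN hψ hη wq).inv := by
  obtain rfl : ν₁ = ((mrelI_nmonoPlus_iff p q).mp hr).choose :=
    (inA_of_wit wp).ν_eq ((mrelI_nmonoPlus_iff p q).mp hr).choose_spec.choose_spec.choose_spec.choose_spec.1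
  obtain rfl : ν₂ = ((mrelI_nmonoPlus_iff p q).mp hr).choose_spec.choose :=
    (inA_of_wit wq).ν_eq ((mrelI_nmonoPlus_iff p q).mp hr).choose_spec.choose_spec.choose_spec.choose_spec.2.1
  unfold θI
  rw [L.Θ_eq hN hψ hη _ wp, L.Θ_eq hN hψ hη _ wq]

/-- **on a same-class pair the extended lift IS abc-iut-f-101's `θAt`** (`ι^{An⊢⊞}` along `ν ⤳ ν` is the identity).
[cite: MochizukiAbsTopIII2015, Definition 3.5 (ii) p.75] -/
theorem θI_eq_θAt {p q : Path a (nmonoPlusVx v)} (hr : MRelI p q) (hr' : MRel p q) :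
    L.θI hN hψ hη I hr = L.θAt hN hψ hη hr' := by
  obtain ⟨ν, hν, hp, hq⟩ := (mrel_nmonoPlus_iff p q).mp hr'
  rw [L.θI_eq hN hψ hη I hr hp.wit hq.wit (LogVertex.Reach.refl hν), L.θAt_eq hN hψ hη hr' hp.wit hq.wit,
    I.chain_refl]
  erw [Functor.whiskerLeft_id', Category.id_comp]

/-- identity law. [cite: MochizukiAbsTopIII2015, Definition 3.5 (ii) p.75] -/
theorem θI_self {p : Path a (nmonoPlusVx v)} (hr : MRelI p p) : L.θI hN hψ hη I hr = 𝟙 _ := by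
  obtain ⟨ν₁, -, hν₁, -, hp, -, -⟩ := (mrelI_nmonoPlus_iff p p).mp hr
  rw [L.θI_eq_θAt hN hψ hη I hr ⟨ν₁, hν₁, hp, hp⟩, L.θAt_self]

/-- **composition law, under the `ι^{An⊢⊞}`-square** (the composites along `ν₁ ⤳ ν₂ ⤳ ν₃` and `ν₁ ⤳ ν₃` agree).
[cite: MochizukiAbsTopIII2015, Definition 3.5 (ii) p.75] -/
theorem θI_trans (hsq : I.SquaresCommute) {p q r : Path a (nmonoPlusVx v)} (h₁ : MRelI p q) (h₂ : MRelI q r)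
    (h₃ : MRelI p r) : L.θI hN hψ hη I h₁ ≫ L.θI hN hψ hη I h₂ = L.θI hN hψ hη I h₃ := by
  obtain ⟨ν₁, ν₂, hν₁, hν₂, hp, hq, h12⟩ := (mrelI_nmonoPlus_iff p q).mp h₁
  obtain ⟨ν₂', ν₃, hν₂', hν₃, hq', hr', h23⟩ := (mrelI_nmonoPlus_iff q r).mp h₂
  obtain rfl : ν₂ = ν₂' := hq.ν_eq hq'
  rw [L.θI_eq hN hψ hη I h₁ hp.wit hq.wit h12, L.θI_eq hN hψ hη I h₂ hq.wit hr'.wit h23,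
    L.θI_eq hN hψ hη I h₃ hp.wit hr'.wit (h12.trans h23)]
  simp only [Category.assoc, Iso.inv_hom_id_assoc]
  rw [← Category.assoc (Functor.whiskerLeft _ _) (Functor.whiskerLeft _ _), ← Functor.whiskerLeft_comp]
  erw [I.chain_trans hsq v h12 h23 (h12.trans h23)]

/-! ### `θI` lies over the structure isomorphisms -/

/-- the structure isomorphism of a telecore edge, its image of the chain: `μ_{φ_{ν₁}}⁻¹ ≫ N(ι^{An⊢⊞}_{ν₁⤳ν₂}) ≫ μ_{φ_{ν₂}} = 𝟙`
in the core category — because `ι^{An⊢⊞}` lies over the identity of `Th⊢[Z]` (`chain_over`) and `μ_{φ_ν}` is made of `hψ_ν`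
(`μ_telE_app`). [cite: MochizukiAbsTopIII2015, Prop 5.8 (vii) p.142] -/
theorem map_chain_app_comp_μ {ν₁ ν₂ : LogVertex (isArc v)} (h : ν₁.Reach ν₂) (X : L.AnMono) :
    ((L.monoTeleOver hN hψ).N (nmonoPlusVx v)).map ((I.chain v h).app X) ≫
        ((L.monoTeleOver hN hψ).μ (telE v ν₂ h.isCross_tgt)).hom.app X =
      ((L.monoTeleOver hN hψ).μ (telE v ν₁ h.isCross_src)).hom.app X := by
  rw [L.μ_telE_app hN hψ, L.μ_telE_app hN hψ]
  change L.κAnMono.functor.map ((L.toEmono v).map ((L.forgetMono v).map ((I.chain v h).app X))) ≫ _ = _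
  rw [I.chain_over v h X]
  erw [← Functor.map_comp_assoc]
  erw [Category.assoc, Iso.inv_hom_id_app, Category.comp_id]
  rfl

include hcoh in
/-- **the extended lift lies over the structure isomorphisms**, with the SAME formula as abc-iut-f-101's `θAt_over`
(Rmk 3.5.1: under the structure functor of `𝒩⊢⊞_v` the chain contributes nothing). [cite: MochizukiAbsTopIII2015, Remark 3.5.1 p.78] -/
theorem θI_over {p q : Path a (nmonoPlusVx v)} (hr : MRelI p q) (x : L.monoTeleDiagram.obj a) :
    ((L.monoTeleOver hN hψ).N (nmonoPlusVx v)).map ((L.θI hN hψ hη I hr).app x) =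
      ((L.monoTeleOver hN hψ).pathIso p).hom.app x ≫ ((L.monoTeleOver hN hψ).pathIso q).inv.app x := by
  obtain ⟨ν₁, ν₂, hν₁, hν₂, hp, hq, h12⟩ := (mrelI_nmonoPlus_iff p q).mp hr
  rw [L.θI_eq hN hψ hη I hr hp.wit hq.wit h12, NatTrans.comp_app, NatTrans.comp_app, Functor.map_comp,
    Functor.map_comp, Functor.whiskerLeft_app]
  let I₁ := ((L.monoTeleOver hN hψ).μ (telE v ν₁ hν₁)).app (((L.monoTeleOver hN hψ).N a).obj x)
  let I₂ := ((L.monoTeleOver hN hψ).μ (telE v ν₂ hν₂)).app (((L.monoTeleOver hN hψ).N a).obj x)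
  have hp' : ((L.monoTeleOver hN hψ).N (nmonoPlusVx v)).map ((L.Θ hN hψ hη hp.wit).hom.app x) =
      ((L.monoTeleOver hN hψ).pathIso p).hom.app x ≫ I₁.inv :=
    (Iso.eq_comp_inv I₁).mpr (L.Θ_over hN hψ hη hcoh hp.wit x)
  have hq' : ((L.monoTeleOver hN hψ).N (nmonoPlusVx v)).mapIso ((L.Θ hN hψ hη hq.wit).app x) =
      ((L.monoTeleOver hN hψ).pathIso q).app x ≪≫ I₂.symm :=
    Iso.ext ((Iso.eq_comp_inv I₂).mpr (L.Θ_over hN hψ hη hcoh hq.wit x))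
  have hq'' : ((L.monoTeleOver hN hψ).N (nmonoPlusVx v)).map ((L.Θ hN hψ hη hq.wit).inv.app x) =
      I₂.hom ≫ ((L.monoTeleOver hN hψ).pathIso q).inv.app x := by
    change (((L.monoTeleOver hN hψ).N (nmonoPlusVx v)).mapIso ((L.Θ hN hψ hη hq.wit).app x)).inv = _
    rw [hq']
    rfl
  have hc : I₁.inv ≫ (((L.monoTeleOver hN hψ).N (nmonoPlusVx v)).map
      ((I.chain v h12).app (((L.monoTeleOver hN hψ).N a).obj x)) ≫ I₂.hom) = 𝟙 _ :=
    (Iso.inv_comp_eq I₁).mpr ((L.map_chain_app_comp_μ hN hψ I h12 _).trans (Category.comp_id _).symm)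
  have hk : I₁.inv ≫ (((L.monoTeleOver hN hψ).N (nmonoPlusVx v)).map
      ((I.chain v h12).app (((L.monoTeleOver hN hψ).N a).obj x)) ≫
        (I₂.hom ≫ ((L.monoTeleOver hN hψ).pathIso q).inv.app x)) = ((L.monoTeleOver hN hψ).pathIso q).inv.app x :=
    (congrArg (fun k => I₁.inv ≫ k) (Category.assoc _ _ _).symm).trans
      (((Category.assoc _ _ _).symm).trans ((congrArg (fun k => k ≫ _) hc).trans (Category.id_comp _)))
  rw [hp', hq'']
  first
    | exact congrArg (fun k => ((L.monoTeleOver hN hψ).pathIso p).hom.app x ≫ k) hk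
    | exact (Category.assoc _ _ _).trans
        (congrArg (fun k => ((L.monoTeleOver hN hψ).pathIso p).hom.app x ≫ k) hk)

/-! ### Pre-composition -/

/-- **pre-composition law** (Def 3.5 (ii) whiskering): the structure isomorphisms of the prefix cancel through the
naturality of the chain. [cite: MochizukiAbsTopIII2015, Definition 3.5 (ii) p.75] -/
theorem θI_precomp_heq {c : (monoTeleShape Vmod isArc).Vertex} (r : Path c a) {p q : Path a (nmonoPlusVx v)}
    (hr : MRelI p q) (hr' : MRelI (r.comp p) (r.comp q)) :
    L.θI hN hψ hη I hr' ≍ Functor.whiskerLeft (L.monoTeleDiagram.pathFunctor r) (L.θI hN hψ hη I hr) := by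
  obtain ⟨ν₁, ν₂, hν₁, hν₂, hp, hq, h12⟩ := (mrelI_nmonoPlus_iff p q).mp hr
  have hp' : InA v ν₁ hν₁ (r.comp p) := hp.precomp r
  have hq' : InA v ν₂ hν₂ (r.comp q) := hq.precomp r
  rw [L.θI_eq hN hψ hη I hr hp.wit hq.wit h12, L.θI_eq hN hψ hη I hr' hp'.wit hq'.wit h12]
  refine natTrans_heq_of_app (DiagramOfCategories.pathFunctor_comp _ _ _) (DiagramOfCategories.pathFunctor_comp _ _ _)
    fun x => ?_
  simp only [NatTrans.comp_app, Functor.whiskerLeft_app]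
  have e₁ := L.Θ_hom_app_precomp_heq hN hψ hη r hp.wit hp'.wit x
  have e₂ := L.Θ_inv_app_precomp_heq hN hψ hη r hq.wit hq'.wit x
  -- the middle: `(N_c ◁ chain)_x = chain_{N_c x}` versus `chain_{N_a (r x)}` conjugated by `ψ(π_r)` (naturality)
  have emid : (I.chain v h12).app (((L.monoTeleOver hN hψ).N c).obj x) =
      (L.ψAnMono v ⟨ν₁, hν₁⟩).map (((L.monoTeleOver hN hψ).pathIso r).inv.app x) ≫
        (I.chain v h12).app (((L.monoTeleOver hN hψ).N a).obj ((L.monoTeleDiagram.pathFunctor r).obj x)) ≫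
          (L.ψAnMono v ⟨ν₂, hν₂⟩).map (((L.monoTeleOver hN hψ).pathIso r).hom.app x) := by
    erw [← Category.assoc, I.chain_naturality v h12 (((L.monoTeleOver hN hψ).pathIso r).inv.app x), Category.assoc,
      ← Functor.map_comp, Iso.inv_hom_id_app, CategoryTheory.Functor.map_id, Category.comp_id]
  rw [emid]
  refine (heq_comp (Functor.congr_obj (DiagramOfCategories.pathFunctor_comp _ r p) x) rfl
    (Functor.congr_obj (DiagramOfCategories.pathFunctor_comp _ r q) x) e₁
    (heq_comp rfl rfl (Functor.congr_obj (DiagramOfCategories.pathFunctor_comp _ r q) x) HEq.rfl e₂)).trans ?_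
  apply heq_of_eq
  erw [Category.assoc, Category.assoc, Category.assoc]
  erw [← Category.assoc ((L.ψAnMono v ⟨ν₁, hν₁⟩).map _) ((L.ψAnMono v ⟨ν₁, hν₁⟩).map _), ← Functor.map_comp,
    Iso.hom_inv_id_app, CategoryTheory.Functor.map_id]
  erw [Category.id_comp]
  erw [← Category.assoc ((L.ψAnMono v ⟨ν₂, hν₂⟩).map _) ((L.ψAnMono v ⟨ν₂, hν₂⟩).map _), ← Functor.map_comp,
    Iso.hom_inv_id_app, CategoryTheory.Functor.map_id]
  erw [Category.id_comp]
  rfl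

/-! ### Post-composition by a telecore edge -/

/-- post-composition by `[φ^{An⊢⊞}_{v′,ν′}] ∘ [τ]` of any homotopy lying over the structure isomorphisms: the composites fall
into ONE class, where the extended lift is abc-iut-f-101's framed lift (`θAt_comp_tel_heq`).
[cite: MochizukiAbsTopIII2015, Definition 3.5 (ii) p.75] -/
theorem θI_comp_tel_heq {a₀ w : (monoTeleShape Vmod isArc).Vertex} {p q : Path a₀ w}
    (θ₀ : L.monoTeleDiagram.pathFunctor p ⟶ L.monoTeleDiagram.pathFunctor q)
    (hover : ∀ x, ((L.monoTeleOver hN hψ).N w).map (θ₀.app x) =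
      ((L.monoTeleOver hN hψ).pathIso p).hom.app x ≫ ((L.monoTeleOver hN hψ).pathIso q).inv.app x)
    (t : Path w (coreVx Vmod isArc)) {v' : Vmod} (ν' : LogVertex (isArc v')) (hν' : ν'.IsCross)
    (hr : MRelI (p.comp (t.cons (telE v' ν' hν'))) (q.comp (t.cons (telE v' ν' hν')))) :
    L.θI hN hψ hη I hr ≍ Functor.whiskerRight θ₀ (L.monoTeleDiagram.pathFunctor (t.cons (telE v' ν' hν'))) := by
  have hr' : MRel (p.comp (t.cons (telE v' ν' hν'))) (q.comp (t.cons (telE v' ν' hν'))) :=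
    ⟨ν', hν', Or.inl ⟨⟨p.comp t, rfl⟩⟩, Or.inl ⟨⟨q.comp t, rfl⟩⟩⟩
  rw [L.θI_eq_θAt hN hψ hη I hr hr']
  exact L.θAt_comp_tel_heq hN hψ hη θ₀ hover t ν' hν' hr'

end Theta

end LogFrobeniusSetting

end Literature.AnabelianGeometry.AbsoluteAnabelian
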